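/-
Origin: expansion seat `prover-pub-hodgecm-mc-binder-2-g14-0`, handover #76 2026-08-20T08:58Z md5 6c08186f9e38 (187 l.; 9 s; imports #75 `KappaSlot`, theta-3 `Model/ArchLineOrient` (RUN 42), carch-1 `Model/ArchKTypeOfOrient` (RUN 41), `Model/ThetaAdelicSideEta` (RUN 40); (V-val) AS ONE ARCHIMEDEAN-TYPE CONDITION ON E's χ_V + ITS LIVE BRANCH: §1 `cmXW_cmPlace_eq_div` (`x_W(v₁) j = re ι₁(a_j) / im ((mk ι₁).embedding δ_L)`), `re_apply_dW_eq`, **`hposW_of_goodCtx_orientBitι`** (at a good context of the bit of record `orientBitι L ι₁` with the canonical representative `(mk ι₁).embedding = ι₁` the PAIR READS POSITIVE at v₁ — E's only live branch; theta-3 `ArchSideTerm.re_a_pos_iff_of_goodCtx`/`re_a_neg_iff_of_goodCtx` + carch-1 `orientBitι_eq_false_iff`/`_true_iff`); §2 **`pairType V S hGR hW hpos : InfinitePlace L → ℤ`** (THE W-side type of χ_V: `w(b) ↦ −pairVacExponent b` off v₁ (#72), `w(v₁) ↦ −e_P(v₁)` (#75)), read-backs `pairType_cmPlaceOver_of_ne`/`pairType_cmPlaceOver_cmPlace`;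 §3 **`hκ_of_hasArchType_pairType`** (E's `hκ` verbatim, all `k ∈ K_∞`, from the SINGLE hypothesis `HasArchType χV (pairType …)` + positive reading + guard), **`exists_unitaryLineChar_hκ`** (SATISFIABILITY: for every χ_W there IS a χ_V with `hκ`; tree `exists_unitaryLineChar_hasArchType`); §4 **`hκ_etaChi_of_hasArchType_pairType`** (the same at the pin children's `η′ = EtaChi.η χV χW`, `SignRecipe.GoodCtx (orientBitι L ι₁)` + `hcan`); NAME LIST `HodgeCM.Model.HypCensus.` × {hκ_of_hasArchType_pairType, hposW_of_goodCtx_orientBitι, exists_unitaryLineChar_hκ} (+ pairType, hκ_etaChi_of_hasArchType_pairType)) (`HOME/mc/pub-hodgecm-mc-binder-2/g14/pkg/HodgeCM/Model/HypCensus/KappaType.lean`, md5 6c08186f9e38, 187 lines);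
landed by the second packager p2 gen 5 (p2-g5) in gate run 46 as `HodgeCM/Model/HypCensus/KappaType.lean` (verbatim).
-/
/-
Copyright (c) 2026. All rights reserved.
Released under Apache 2.0 license as described in the file LICENSE.
-/
import Summits.HodgeConjecture.HodgeCM.Model.HypCensus.KappaSlot
import Summits.HodgeConjecture.HodgeCM.Model.ArchLineOrient
import Summits.HodgeConjecture.HodgeCM.Model.ArchKTypeOfOrient
import Summits.HodgeConjecture.HodgeCM.Model.ThetaAdelicSideEta

/-!
# (V-val) as ONE archimedean-type condition on E's `χ_V`, and its live branch at E's good canonical contexts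

Binder-2 lineage, rows 18/19 (`hyp12`/`hyp34`).  #75 (`KappaSlot`) proves E's hypothesis family `hκ` from the (S-norm) type equations of
`χ_V` at every real place, in the positive `W`-reading at `v₁` and for the canonical representative.  This leaf packages that:

* §1 **`hposW_of_goodCtx_orientBitι`** — E's ONLY LIVE BRANCH: at a good context of the bit of record `orientBitι L ι₁` and for the
  canonical representative `(mk ι₁).embedding = ι₁` the pair's `W = ⟨a₀, a₁⟩` READS POSITIVE at `v₁` (`∀ j, 0 < x_W(v₁) j`): the forced signs
  give `sign re ι₁(a_j) = sign im ι₁(δ_L)` (theta-3 `ArchSideTerm.re_a_pos_iff_of_goodCtx`, carch-1 `orientBitι_eq_false_iff`) and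
  `x_W(v₁) j = re ι₁(a_j) / im ι₁(δ_L)` (`cmXW_cmPlace_apply`, `cmSignConv v₁ = 1`, `cmPlaceOver_eq_mk`).
* §2 **`pairType V S hGR hW hpos : InfinitePlace L → ℤ`** — THE archimedean type the W side asks of `χ_V`: `w(b) ↦ −pairVacExponent b`
  (`b ≠ v₁`, #72) and `w(v₁) ↦ −e_P(v₁)` (#75 `iotaVacExponents`); read-backs `pairType_cmPlaceOver_of_ne` / `pairType_cmPlaceOver_cmPlace`.
* §3 **`hκ_of_hasArchType_pairType`** — `hκ` (#51/#61/#70/#71 verbatim, all `k ∈ K_∞`) at `η = (χ_V∘det_V)·(χ_W∘det_W)` from the SINGLE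
  hypothesis `HasArchType χ_V (pairType …)` (+ positive reading + guard); hence **`exists_unitaryLineChar_hκ`**: for EVERY `χ_W` there IS a
  `χ_V` with `hκ` (tree `exists_unitaryLineChar_hasArchType`) — the (V-val) family is SATISFIABLE at every good canonical context; what E must
  check is only that ITS `χ_V` (shared with the S side, binder groups `harch₀ hχ₀ harch₁ hχ₁`) has this type.
* §4 the same read at the `EtaChi.η χV χW` family of the pin children (#397/#398/#399T): **`hκ_etaChi_of_hasArchType_pairType`**.

Nothing here is a claim of PerL/QW8; bracketed references are provenance of the tree theorems used.
[GelbartRogawski1991, §3.1 Prop. 3.1.1, Remark p. 457; Folland1989, Prop. (4.39); KonnoKonno2007, Lemma 5.2]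
-/

noncomputable section

open NumberField NumberField.InfinitePlace IsDedekindDomain
open scoped Matrix Classical TensorProduct
open MvPolynomial
open Literature.NumberTheory.Automorphic Literature.NumberTheory.Automorphic.UnitaryGroup Literature.NumberTheory.Weil1964
open Literature.RepresentationTheory.KonnoKonno2007 Literature.RepresentationTheory.KonnoKonno2007.RealDualPair
open Literature.NumberTheory.GelbartRogawski1991 Literature.NumberTheory.GelbartRogawski1991.UnitaryDualPair
open Literature.Analysis.SegalBargmann
open HodgeCM HodgeCM.Model HodgeCM.Adelic

namespace HodgeCM.Model.HypCensus

/-! ## §1 E's live branch: the pair reads positive at `v₁` at a good context of the bit of record, canonical representative -/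

section Live

variable {L : CMField} {ι₁ : L →+* ℂ} (V : HermSpace3 L ι₁)

/-- **the canonical `W`-sign of the pair at the place under `ι₁`, in closed form**: `x_W(v₁) j = re ι₁(a_j) / im ((mk ι₁).embedding δ_L)`
(the `(2,1)` frame `frameD V` makes `cmSignConv v₁ = 1`). -/
theorem cmXW_cmPlace_eq_div (S : StubTree.SeesawDatum L) (j : Fin 2) :
    cmXW (L : Type) (frameD V) (dW S) (dW_real S) ι₁ (cmPlace (L : Type) ι₁) j =
      (ι₁ (dW S j)).re / ((InfinitePlace.mk ι₁).embedding (imagUnit (L : Type))).im := by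
  rw [cmXW_cmPlace_apply (L : Type) (frameD V) (dW S) (dW_real S) ι₁ j]
  show (ι₁ (dW S j)).re / ((((cmPlaceOver (L : Type) (cmPlace (L : Type) ι₁)).1.embedding (imagUnit (L : Type))).im /
      cmSignConv (L : Type) (frameD V) ι₁ (cmPlace (L : Type) ι₁))) = _
  rw [cmSignConv_cmPlace_eq_one (L : Type) (frameD V) ι₁ (frameD_h21' V), div_one,
    cmPlaceOver_eq_mk (L : Type) (cmPlace (L : Type) ι₁) ι₁ rfl]

/-- the two lines of the pair are context lines `a₀`, `a₁`. -/
theorem re_apply_dW_eq (c : SeesawCtx L) (j : Fin 2) : (ι₁ (dW c.D j)).re = (ι₁ (c.D.a (Fin.castLE (by norm_num) j))).re := by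
  fin_cases j <;> rfl

/-- **E's LIVE BRANCH: at a good context of the bit of record, canonical representative, the pair READS POSITIVE at `v₁`.**
(forced signs: `sign re ι₁(a_j) = sign im ι₁(δ_L)`; theta-3 `re_a_pos_iff_of_goodCtx`/`re_a_neg_iff_of_goodCtx`, carch-1 `orientBitι`). -/
theorem hposW_of_goodCtx_orientBitι {c : SeesawCtx L} (hc : SignRecipe.GoodCtx (orientBitι L ι₁) ι₁ c)
    (hcan : (InfinitePlace.mk ι₁).embedding = ι₁) (j : Fin 2) :
    0 < cmXW (L : Type) (frameD V) (dW c.D) (dW_real c.D) ι₁ (cmPlace (L : Type) ι₁) j := by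
  rw [cmXW_cmPlace_eq_div V c.D j, hcan, re_apply_dW_eq]
  cases hb : orientBitι L ι₁
  · have him : 0 < (ι₁ (imagUnit (L : Type))).im := orientBitι_eq_false_iff.mp hb
    have hre : 0 < (ι₁ (c.D.a (Fin.castLE (by norm_num) j))).re :=
      (ArchSideTerm.re_a_pos_iff_of_goodCtx (hb ▸ hc) _).2 rfl
    exact div_pos hre him
  · have him : (ι₁ (imagUnit (L : Type))).im < 0 := orientBitι_eq_true_iff.mp hb
    have hre : (ι₁ (c.D.a (Fin.castLE (by norm_num) j))).re < 0 :=
      (ArchSideTerm.re_a_neg_iff_of_goodCtx (hb ▸ hc) _).2 rfl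
    exact div_pos_of_neg_of_neg hre him

end Live

/-! ## §2 The archimedean type the W side asks of `χ_V` -/

section PairType

variable {L : CMField} {ι₁ : L →+* ℂ} (V : HermSpace3 L ι₁) (S : StubTree.SeesawDatum L)
variable
  (hGR : (cmSplittingDatum (L : Type) finProdFinEquiv (frameD V) (frameD_real V) (frameD_ne V) (dW S) (dW_real S) (dW_ne S)).CompatibleSplitting)
  (hW : (∀ j, 0 < (ι₁ ((dW S) j)).re) ∨ ∀ j, (ι₁ ((dW S) j)).re < 0)

/-- **THE W-SIDE TYPE OF `χ_V`**: at the complex place over a real `b ≠ v₁` the value `−pairVacExponent b` (#72: the raw vacuum exponent of the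
pair at the definite place `b`), at the place over `v₁` the value `−e_P(v₁)` (#75 `iotaVacExponents`). -/
def pairType (hpos : ∀ j, 0 < cmXW (L : Type) (frameD V) (dW S) (dW_real S) ι₁ (cmPlace (L : Type) ι₁) j) :
    InfinitePlace (L : Type) → ℤ := fun w =>
  if cmPlacesEquiv (L : Type) w = cmPlace (L : Type) ι₁ then -(iotaVacExponents V S hGR hW hpos).eP
  else -pairVacExponent V S hGR hW (cmPlacesEquiv (L : Type) w)

/-- read-back off `v₁`. -/
theorem pairType_cmPlaceOver_of_ne (hpos : ∀ j, 0 < cmXW (L : Type) (frameD V) (dW S) (dW_real S) ι₁ (cmPlace (L : Type) ι₁) j)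
    (b : {v : InfinitePlace ↥(maximalRealSubfield L) // v.IsReal}) (hb : b ≠ cmPlace (L : Type) ι₁) :
    pairType V S hGR hW hpos (cmPlaceOver (L : Type) b).1 = -pairVacExponent V S hGR hW b := by
  unfold pairType
  rw [← cmPlacesEquiv_symm_apply, Equiv.apply_symm_apply, if_neg hb]

/-- read-back at `v₁`. -/
theorem pairType_cmPlaceOver_cmPlace (hpos : ∀ j, 0 < cmXW (L : Type) (frameD V) (dW S) (dW_real S) ι₁ (cmPlace (L : Type) ι₁) j) :
    pairType V S hGR hW hpos (cmPlaceOver (L : Type) (cmPlace (L : Type) ι₁)).1 = -(iotaVacExponents V S hGR hW hpos).eP := by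
  unfold pairType
  rw [← cmPlacesEquiv_symm_apply, Equiv.apply_symm_apply, if_pos rfl]

end PairType

/-! ## §3 `hκ` from ONE archimedean-type hypothesis on `χ_V`; satisfiability -/

section Val

variable {L : CMField} {ι₁ : L →+* ℂ} (V : HermSpace3 L ι₁) (S : StubTree.SeesawDatum L)
variable
  (hGR : (cmSplittingDatum (L : Type) finProdFinEquiv (frameD V) (frameD_real V) (frameD_ne V) (dW S) (dW_real S) (dW_ne S)).CompatibleSplitting)
  (hW : (∀ j, 0 < (ι₁ ((dW S) j)).re) ∨ ∀ j, (ι₁ ((dW S) j)).re < 0)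
variable (χV χW : ContinuousMonoidHom
  (Literature.NumberTheory.Automorphic.relNormOneIdeles (↥(maximalRealSubfield L)) (L : Type) ⧸
    Literature.NumberTheory.Automorphic.relNormOneRat (↥(maximalRealSubfield L)) (L : Type)) Circle)

/-- **(V-val) FROM ONE TYPE HYPOTHESIS**: if `χ_V` has archimedean type `pairType` (positive reading at `v₁`, canonical representative), E's
hypothesis family `hκ` (#51/#61/#70/#71 verbatim) holds at `η = (χ_V∘det_V)·(χ_W∘det_W)` for EVERY `χ_W` and every `k ∈ K_∞`.
[GelbartRogawski1991, §3.1 Remark p. 457; Folland1989, Prop. (4.39); KonnoKonno2007, Lemma 5.2] -/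
theorem hκ_of_hasArchType_pairType (hpos : ∀ j, 0 < cmXW (L : Type) (frameD V) (dW S) (dW_real S) ι₁ (cmPlace (L : Type) ι₁) j)
    (hcan : (InfinitePlace.mk ι₁).embedding = ι₁)
    (hnV : UnitaryLineChar.HasArchType (L : Type) χV (pairType V S hGR hW hpos)) (k : ↥(KInfty V)) :
    ((cmDetTwistChar (L : Type) (frameD V) (frameD_ne V) (dW S) (dW_ne S) (charOfUnitaryLineChar (L : Type) χV)
          (charOfUnitaryLineChar (L : Type) χW) (kPair V S ι₁ V.sylvesterFrame (sylvesterFrame_formCongr V) k) : ℂˣ) : ℂ) *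
        ((pinLetterChar V S hGR hW (kVLetters V S (lett V S k)) : Circle) : ℂ) * dVIota V S (lett V S k (cmPlace (L : Type) ι₁)) =
      ((UnitaryGroup.archKappa (L : Type) V.Hm ι₁ V.sylvesterFrame (sylvesterFrame_formCongr V) k : ℂˣ) : ℂ) :=
  hκ_of_type_of_pos V S hGR hW χV χW hnV hpos hcan (fun b hb => pairType_cmPlaceOver_of_ne V S hGR hW hpos b hb)
    (pairType_cmPlaceOver_cmPlace V S hGR hW hpos) k

/-- **SATISFIABILITY of (V-val)**: for every `χ_W` there is a `χ_V` (of type `pairType`; tree `exists_unitaryLineChar_hasArchType`) for which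
E's `hκ` holds at every `k ∈ K_∞` (positive reading at `v₁`, canonical representative). -/
theorem exists_unitaryLineChar_hκ (hpos : ∀ j, 0 < cmXW (L : Type) (frameD V) (dW S) (dW_real S) ι₁ (cmPlace (L : Type) ι₁) j)
    (hcan : (InfinitePlace.mk ι₁).embedding = ι₁) :
    ∃ χV' : ContinuousMonoidHom
        (Literature.NumberTheory.Automorphic.relNormOneIdeles (↥(maximalRealSubfield L)) (L : Type) ⧸
          Literature.NumberTheory.Automorphic.relNormOneRat (↥(maximalRealSubfield L)) (L : Type)) Circle,
      UnitaryLineChar.HasArchType (L : Type) χV' (pairType V S hGR hW hpos) ∧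
      ∀ k : ↥(KInfty V),
        ((cmDetTwistChar (L : Type) (frameD V) (frameD_ne V) (dW S) (dW_ne S) (charOfUnitaryLineChar (L : Type) χV')
              (charOfUnitaryLineChar (L : Type) χW) (kPair V S ι₁ V.sylvesterFrame (sylvesterFrame_formCongr V) k) : ℂˣ) : ℂ) *
            ((pinLetterChar V S hGR hW (kVLetters V S (lett V S k)) : Circle) : ℂ) * dVIota V S (lett V S k (cmPlace (L : Type) ι₁)) =
          ((UnitaryGroup.archKappa (L : Type) V.Hm ι₁ V.sylvesterFrame (sylvesterFrame_formCongr V) k : ℂˣ) : ℂ) := by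
  obtain ⟨χV', hχ⟩ := exists_unitaryLineChar_hasArchType (L : Type) (pairType V S hGR hW hpos)
  exact ⟨χV', hχ, hκ_of_hasArchType_pairType V S hGR hW χV' χW hpos hcan hχ⟩

end Val

/-! ## §4 At the `EtaChi.η` family of the pin children -/

section EtaChiFamily

variable
  (χV χW : ∀ {L : CMField} {ι₁ : L →+* ℂ} (_V : HermSpace3 L ι₁) (_c : SeesawCtx L),
    ContinuousMonoidHom (Literature.NumberTheory.Automorphic.relNormOneIdeles (maximalRealSubfield (L : Type)) (L : Type) ⧸
      Literature.NumberTheory.Automorphic.relNormOneRat (maximalRealSubfield (L : Type)) (L : Type)) Circle)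
variable
  (hGR : ∀ {L : CMField} {ι₁ : L →+* ℂ} (V : HermSpace3 L ι₁) (c : SeesawCtx L),
    (cmSplittingDatum (L : Type) finProdFinEquiv (frameD V) (frameD_real V) (frameD_ne V) (dW c.D) (dW_real c.D) (dW_ne c.D)).CompatibleSplitting)

/-- **(V-val) AT THE PIN CHILDREN'S `η′ = EtaChi.η χV χW`** (#397/#398/#399T): at a good context of the bit of record with the canonical
representative, the rows-18/19 hypothesis `hκ V c hW` holds for every `k ∈ K_∞` as soon as `χV V c` has archimedean type `pairType`. -/
theorem hκ_etaChi_of_hasArchType_pairType {L : CMField} {ι₁ : L →+* ℂ} (V : HermSpace3 L ι₁) {c : SeesawCtx L}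
    (hc : SignRecipe.GoodCtx (orientBitι L ι₁) ι₁ c) (hcan : (InfinitePlace.mk ι₁).embedding = ι₁)
    (hW : (∀ j, 0 < (ι₁ ((dW c.D) j)).re) ∨ ∀ j, (ι₁ ((dW c.D) j)).re < 0)
    (hnV : UnitaryLineChar.HasArchType (L : Type) (χV V c)
      (pairType V c.D (hGR V c) hW (hposW_of_goodCtx_orientBitι V hc hcan)))
    (k : ↥(KInfty V)) :
    ((EtaChi.η @χV @χW V c (kPair V c.D ι₁ V.sylvesterFrame (sylvesterFrame_formCongr V) k) : ℂˣ) : ℂ) *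
        ((pinLetterChar V c.D (hGR V c) hW (kVLetters V c.D (lett V c.D k)) : Circle) : ℂ) * dVIota V c.D (lett V c.D k (cmPlace (L : Type) ι₁)) =
      ((UnitaryGroup.archKappa (L : Type) V.Hm ι₁ V.sylvesterFrame (sylvesterFrame_formCongr V) k : ℂˣ) : ℂ) :=
  hκ_of_hasArchType_pairType V c.D (hGR V c) hW (χV V c) (χW V c) (hposW_of_goodCtx_orientBitι V hc hcan) hcan hnV k

end EtaChiFamily

end HodgeCM.Model.HypCensus

end
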